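import Summits.Ventures.LatticeQCDFlow.TrivializingMaps.SpecificHeatCeilingTwoDim
import Summits.Ventures.LatticeQCDFlow.Scaling.DefectSwapAcceptance

/-!
HONEST FRAMING: exact (Metropolis-corrected) sampling algorithms for lattice gauge theory; figures
of merit are autocorrelation/cost numbers at stated couplings and volumes; no continuum-physics
claim.

# DefectSpecificHeatCeilingTwoDim — IN TWO DIMENSIONS THE DEFECT SPECIFIC HEAT IS `O(#D)` AT EVERY BULK AND
# EVERY DEFECT COUPLING: `Var_{μ_{β,u}}(S_D) ≤ N²·e^{2N|β|}·#D` FOR EVERY PROPER SET `D` OF PLAQUETTES OF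
# `(ℤ/L)²`, EVERY COMPACT GAUGE GROUP (lean-2 GEN-12, ours)

Venture-side (OURS).  Cell `lqcd-flow` (pub-lqcd), unit `pub-lqcd-lean-2-g12`, 2026-08-23.  Defect companion
of `TrivializingMaps/SpecificHeatCeilingTwoDim`.  GEN-11's `Scaling/DefectSwapAcceptance` priced the PTBC swap
between defect couplings `u < u'` of the family `μ_{β,u} ∝ exp(−β S_{Dᶜ} − u S_D) dU` from above by lean-1's
defect floor (DVF) (`Ω(√#D)` replicas) but from below only by the trivial ceiling `(N#D)²` (`O(#D)` replicas;
"sharp `#D`-dependence NOT CLAIMED").  In `d = 2` the gap closes: with a puncture `x₀` off `D`, `μ_{β,u}` is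
the tilt by ONE bulk plaquette `−β s(U_{x₀})` (oscillation `2N|β|`) of a punctured measure under which the
`L² − 1` off-puncture plaquettes are INDEPENDENT with SITE-DEPENDENT tilts `−c_x s` (`c_x = u` on `D`, `β`
off `D`; lean-1's `map_plaquettes_eq_pi`, `Scaling.pi_tilted_sum`), so
`Var_{μ_{β,u}}(S_D) ≤ e^{2N|β|}·#D·Var_{one plaquette} ≤ N²e^{2N|β|}·#D`, uniformly in `u` and `L`.

What is proved (`L ≥ 2`, compact second-countable `G`, continuous `ρ : G →* M_N(ℂ)`, `D` a finite set of
plaquettes of `(ℤ/L)²` with `Dᶜ` nonempty, all real `β, u, v`): §1 site bookkeeping (`defectSum_two_eq`,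
`defect_potential_two_eq`); §2 `map_punctured_eq_pi_field` (push-forward of the punctured field measure =
product of one-plaquette tilts), `variance_punctured_indicator_le`, **`defect_variance_le_twoDim`**
(`Var_{μ_{β,u}}(S_D) ≤ N²e^{2N|β|}#D`) and its family spelling `defect_ceiling_family_twoDim`
(`Var[−S_D; ν_β.tilted(v·(−S_D))] ≤ N²e^{2N|β|}#D` for EVERY `v`).  The PTBC consequences (two-sided
`Θ((c_K − c_0)·√#D)` replicas in `d = 2`) are in `Scaling/DefectSwapAcceptanceTwoDim`.
NOT CLAIMED: `d ≥ 3`; sharp constants.  Literature grade: KNOWN MECHANISM, NEW TYPING; nothing is cited as a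
fact.
-/

noncomputable section

open MeasureTheory ProbabilityTheory Real Set
open Literature.MathematicalPhysics.QuantumFieldTheory
open Literature.MathematicalPhysics.QuantumFieldTheory.Luscher2010
open Summit.Ventures.LatticeQCDFlow.Theory2.Lattice.TwoDim
open Summit.Ventures.LatticeQCDFlow.TrivializingMaps
open Literature.Probability.LatticeModels (integrable_of_continuous_compactSpace map_tilted_comp)

namespace Summit.Ventures.LatticeQCDFlow.Scaling

section DefectTwoDim

variable {L N : ℕ} [NeZero L] {G : Type*} [Group G] [TopologicalSpace G] [IsTopologicalGroup G]
  [CompactSpace G] [MeasurableSpace G] [BorelSpace G] [SecondCountableTopology G]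
  (ρ : G →* Matrix (Fin N) (Fin N) ℂ)

/-! ## §1 Site bookkeeping on `(ℤ/L)²` -/

omit [NeZero L] in
/-- On `(ℤ/L)²` a plaquette is determined by its base site. [folklore] -/
theorem plaquette_two_fst_injective : Function.Injective (Prod.fst : Plaquette 2 L → Site 2 L) := by
  intro p q h
  exact Prod.ext h ((plane_eq_zero_one p.2).trans (plane_eq_zero_one q.2).symm)

omit [NeZero L] in
/-- `Σ_{p ∈ A} F(p.1) = Σ_{x ∈ A.image fst} F(x)` for plaquettes of `(ℤ/L)²`. [folklore] -/
theorem sum_plaquette_fst_eq_sum_image (A : Finset (Plaquette 2 L)) (F : Site 2 L → ℝ) :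
    ∑ p ∈ A, F p.1 = ∑ x ∈ A.image Prod.fst, F x := by
  classical
  rw [Finset.sum_image fun p _ q _ h => plaquette_two_fst_injective h]

omit [NeZero L] [TopologicalSpace G] [IsTopologicalGroup G] [CompactSpace G] [MeasurableSpace G]
  [BorelSpace G] [SecondCountableTopology G] in
/-- The plaquette term of `p` is the `(0,1)`-term at its base site. [folklore] -/
theorem plaqTerm_two_eq (U : GaugeConfig 2 L G) (p : Plaquette 2 L) :
    ((N : ℝ) - (ρ (plaquetteHolonomy U p.1 p.2.1.1 p.2.1.2)).trace.re) =
      ((N : ℝ) - (ρ (plaquetteHolonomy U p.1 0 1)).trace.re) := by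
  rw [plane_eq_zero_one p.2]

omit [TopologicalSpace G] [IsTopologicalGroup G] [CompactSpace G] [MeasurableSpace G] [BorelSpace G]
  [SecondCountableTopology G] in
/-- **The defect action as an indicator-weighted site sum**: `S_D(U) = Σ_x 1_{D'}(x)·s(U_x)`,
`D' = D.image fst`. [folklore] -/
theorem defectSum_two_eq (D : Finset (Plaquette 2 L)) (U : GaugeConfig 2 L G) :
    (∑ p ∈ D, ((N : ℝ) - (ρ (plaquetteHolonomy U p.1 p.2.1.1 p.2.1.2)).trace.re)) =
      ∑ x : Site 2 L, if x ∈ D.image Prod.fst then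
        ((N : ℝ) - (ρ (plaquetteHolonomy U x 0 1)).trace.re) else 0 := by
  classical
  rw [Finset.sum_congr rfl fun p _ => plaqTerm_two_eq ρ U p,
    sum_plaquette_fst_eq_sum_image _ fun x => (N : ℝ) - (ρ (plaquetteHolonomy U x 0 1)).trace.re]
  symm
  rw [Finset.sum_ite_mem, Finset.univ_inter]

omit [TopologicalSpace G] [IsTopologicalGroup G] [CompactSpace G] [MeasurableSpace G] [BorelSpace G]
  [SecondCountableTopology G] in
/-- **The two-coupling potential as a site sum**: `β·S_{Dᶜ}(U) + u·S_D(U) = Σ_x c_x·s(U_x)` with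
`c_x = u` for `x ∈ D'` and `c_x = β` otherwise. [folklore] -/
theorem defect_potential_two_eq (D : Finset (Plaquette 2 L)) (β u : ℝ) (U : GaugeConfig 2 L G) :
    β * (∑ p ∈ Dᶜ, ((N : ℝ) - (ρ (plaquetteHolonomy U p.1 p.2.1.1 p.2.1.2)).trace.re)) +
      u * (∑ p ∈ D, ((N : ℝ) - (ρ (plaquetteHolonomy U p.1 p.2.1.1 p.2.1.2)).trace.re)) =
    ∑ x : Site 2 L, (if x ∈ D.image Prod.fst then u else β) *
      ((N : ℝ) - (ρ (plaquetteHolonomy U x 0 1)).trace.re) := by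
  classical
  have hcompl : (∑ p ∈ Dᶜ, ((N : ℝ) - (ρ (plaquetteHolonomy U p.1 p.2.1.1 p.2.1.2)).trace.re)) =
      (∑ x : Site 2 L, ((N : ℝ) - (ρ (plaquetteHolonomy U x 0 1)).trace.re)) -
        ∑ p ∈ D, ((N : ℝ) - (ρ (plaquetteHolonomy U p.1 p.2.1.1 p.2.1.2)).trace.re) := by
    rw [← wilsonAction_two_eq_sum_sites ρ U, eq_sub_iff_add_eq, Finset.sum_compl_add_sum]
    rfl
  rw [hcompl, defectSum_two_eq ρ D U, mul_sub, Finset.mul_sum, Finset.mul_sum, Finset.mul_sum,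
    ← Finset.sum_sub_distrib, ← Finset.sum_add_distrib]
  refine Finset.sum_congr rfl fun x _ => ?_
  split_ifs <;> ring

/-! ## §2 The defect specific-heat ceiling in two dimensions -/

/-- **THE PUNCTURED STRUCTURE WITH SITE-DEPENDENT COUPLINGS** (`L ≥ 2`, coupling field `c : Site → ℝ`,
puncture `x₀`): the push-forward of `D[U].tilted(Σ_{x ≠ x₀} −c_x s(U_x))` under `U ↦ (U_x)_{x ≠ x₀}` is the
product `⨂_{x ≠ x₀} Haar.tilted(−c_x s)`. [ours] -/
theorem map_punctured_eq_pi_field (hL : 2 ≤ L) (hρ : Continuous ρ) (x₀ : Site 2 L) (c : Site 2 L → ℝ) :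
    ((trivialMeasure G 2 L).tilted fun U => ∑ i : {x : Site 2 L // x ≠ x₀},
        -(c i.1 * ((N : ℝ) - (ρ (plaquetteHolonomy U i.1 0 1)).trace.re))).map
      (fun (U : GaugeConfig 2 L G) (i : {x : Site 2 L // x ≠ x₀}) => plaquetteHolonomy U i.1 0 1) =
    Measure.pi fun i : {x : Site 2 L // x ≠ x₀} =>
      (haarProbability G).tilted fun g => -(c i.1 * ((N : ℝ) - (ρ g).trace.re)) := by
  have hΦ : Measurable fun (U : GaugeConfig 2 L G) (i : {x : Site 2 L // x ≠ x₀}) =>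
      plaquetteHolonomy U i.1 0 1 :=
    measurable_pi_lambda _ fun i => measurable_plaquetteHolonomy i.1
  have hf : ∀ i : {x : Site 2 L // x ≠ x₀},
      Measurable fun g : G => -(c i.1 * ((N : ℝ) - (ρ g).trace.re)) := fun i =>
    (continuous_const.mul (continuous_plaqTerm ρ hρ)).neg.measurable
  have hF : Measurable fun ω : {x : Site 2 L // x ≠ x₀} → G =>
      ∑ i, -(c i.1 * ((N : ℝ) - (ρ (ω i)).trace.re)) :=
    Finset.measurable_sum _ fun i _ => (hf i).comp (measurable_pi_apply i)
  have h := map_tilted_comp (trivialMeasure G 2 L) hΦ hF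
  rw [Function.comp_def] at h
  rw [h]
  unfold trivialMeasure
  rw [map_plaquettes_eq_pi hL x₀]
  have hint : ∀ i : {x : Site 2 L // x ≠ x₀},
      Integrable (fun g : G => exp (-(c i.1 * ((N : ℝ) - (ρ g).trace.re)))) (haarProbability G) :=
    fun i => integrable_of_continuous_compactSpace (haarProbability G)
      (continuous_exp.comp (continuous_const.mul (continuous_plaqTerm ρ hρ)).neg)
  exact pi_tilted_sum (fun _ : {x : Site 2 L // x ≠ x₀} => haarProbability G)
    (fun i g => -(c i.1 * ((N : ℝ) - (ρ g).trace.re))) hint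

/-- **Variance of an indicator-weighted plaquette sum under the punctured field measure**: for a set `D'`
of sites, `Var[Σ_{x ≠ x₀} 1_{D'}(x) s(U_x)] ≤ #D'·N²`. [ours] -/
theorem variance_punctured_indicator_le (hL : 2 ≤ L) (hρ : Continuous ρ) (x₀ : Site 2 L)
    (c : Site 2 L → ℝ) (D' : Finset (Site 2 L)) :
    variance (fun U : GaugeConfig 2 L G => ∑ i : {x : Site 2 L // x ≠ x₀},
        if i.1 ∈ D' then ((N : ℝ) - (ρ (plaquetteHolonomy U i.1 0 1)).trace.re) else 0)
      ((trivialMeasure G 2 L).tilted fun U => ∑ i : {x : Site 2 L // x ≠ x₀},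
        -(c i.1 * ((N : ℝ) - (ρ (plaquetteHolonomy U i.1 0 1)).trace.re))) ≤
      (D'.card : ℝ) * (N : ℝ) ^ 2 := by
  classical
  set s : G → ℝ := fun g => (N : ℝ) - (ρ g).trace.re with hs_def
  have hs_cont : Continuous s := continuous_plaqTerm ρ hρ
  have hs_mem : ∀ g, s g ∈ Icc (0 : ℝ) (2 * N) := fun g => plaqTerm_mem_Icc ρ hρ g
  let π₁ : {x : Site 2 L // x ≠ x₀} → Measure G := fun i =>
    (haarProbability G).tilted fun g => -(c i.1 * s g)
  haveI hπ : ∀ i, IsProbabilityMeasure (π₁ i) := fun i => isProbabilityMeasure_tilted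
    (integrable_of_continuous_compactSpace (haarProbability G)
      (continuous_exp.comp (continuous_const.mul hs_cont).neg))
  let Φ : GaugeConfig 2 L G → ({x : Site 2 L // x ≠ x₀} → G) := fun U i => plaquetteHolonomy U i.1 0 1
  have hΦ : Measurable Φ := measurable_pi_lambda _ fun i => measurable_plaquetteHolonomy i.1
  let X : {x : Site 2 L // x ≠ x₀} → G → ℝ := fun i => if i.1 ∈ D' then s else 0
  have hX : ∀ i g, X i g = if i.1 ∈ D' then s g else 0 := fun i g => by
    by_cases h : i.1 ∈ D' <;> simp [X, h]
  let T : ({x : Site 2 L // x ≠ x₀} → G) → ℝ := ∑ i, fun ω => X i (ω i)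
  have hT : ∀ ω, T ω = ∑ i, X i (ω i) := fun ω => by simp only [T, Finset.sum_apply]
  have hXc : ∀ i, Continuous (X i) := fun i => by
    by_cases h : i.1 ∈ D'
    · simp only [X, if_pos h]; exact hs_cont
    · simp only [X, if_neg h]; exact continuous_const
  have hTc : Continuous T :=
    (continuous_finsetSum _ fun i _ => (hXc i).comp (continuous_apply i)).congr fun ω => (hT ω).symm
  have hobs : (fun U : GaugeConfig 2 L G => ∑ i : {x : Site 2 L // x ≠ x₀},
      if i.1 ∈ D' then ((N : ℝ) - (ρ (plaquetteHolonomy U i.1 0 1)).trace.re) else 0) = T ∘ Φ := by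
    funext U
    rw [Function.comp_apply, hT]
    exact Finset.sum_congr rfl fun i _ => (hX i _).symm
  rw [hobs, ← variance_map hTc.measurable.aemeasurable hΦ.aemeasurable,
    map_punctured_eq_pi_field ρ hL hρ x₀ c]
  have hmem : ∀ i : {x : Site 2 L // x ≠ x₀}, MemLp (X i) 2 (π₁ i) := fun i =>
    MemLp.of_bound (hXc i).aestronglyMeasurable (2 * N) (ae_of_all _ fun g => by
      have h := hs_mem g
      rw [hX, Real.norm_eq_abs]
      split_ifs
      · rw [abs_le]; constructor <;> linarith [h.1, h.2]
      · simp only [abs_zero]; positivity)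
  have hsum := variance_sum_pi (μ := π₁) (X := X) hmem
  rw [show (∑ i, fun ω : {x : Site 2 L // x ≠ x₀} → G => X i (ω i)) = T from rfl] at hsum
  rw [show (fun i : {x : Site 2 L // x ≠ x₀} =>
      (haarProbability G).tilted fun g => -(c i.1 * ((N : ℝ) - (ρ g).trace.re))) = π₁ from rfl, hsum]
  -- per-coordinate: `Var[X_i] ≤ 1_{D'}(i)·N²`
  have hvar1 : ∀ i : {x : Site 2 L // x ≠ x₀},
      variance (X i) (π₁ i) ≤ if i.1 ∈ D' then (N : ℝ) ^ 2 else 0 := by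
    intro i
    by_cases h : i.1 ∈ D'
    · simp only [X, if_pos h]
      have hv := variance_le_sq_of_bounded (μ := π₁ i) (ae_of_all _ hs_mem) hs_cont.measurable.aemeasurable
      calc variance s (π₁ i) ≤ ((2 * N - 0) / 2) ^ 2 := hv
        _ = (N : ℝ) ^ 2 := by ring
    · simp only [X, if_neg h, variance_zero, le_refl]
  calc ∑ i : {x : Site 2 L // x ≠ x₀}, variance (X i) (π₁ i)
      ≤ ∑ i : {x : Site 2 L // x ≠ x₀}, (if i.1 ∈ D' then (N : ℝ) ^ 2 else 0) :=
        Finset.sum_le_sum fun i _ => hvar1 i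
    _ = ∑ x ∈ ({x₀}ᶜ : Finset (Site 2 L)), (if x ∈ D' then (N : ℝ) ^ 2 else 0) :=
        (Finset.sum_subtype _ (fun x => by simp [Finset.mem_compl])
          (fun x : Site 2 L => if x ∈ D' then (N : ℝ) ^ 2 else 0)).symm
    _ ≤ ∑ x : Site 2 L, (if x ∈ D' then (N : ℝ) ^ 2 else 0) :=
        Finset.sum_le_sum_of_subset_of_nonneg (Finset.subset_univ _) fun x _ _ => by
          split_ifs <;> positivity
    _ = (D'.card : ℝ) * (N : ℝ) ^ 2 := by
        rw [Finset.sum_ite_mem, Finset.univ_inter, Finset.sum_const, nsmul_eq_mul]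

/-- **THE TWO-DIMENSIONAL DEFECT SPECIFIC-HEAT CEILING**: for every finite set `D` of plaquettes of
`(ℤ/L)²` (`L ≥ 2`) with `Dᶜ` nonempty and all real `β`, `u`:
`Var_{μ_{β,u}}(S_D) ≤ N²·exp(2N|β|)·#D`, where `μ_{β,u} ∝ exp(−β S_{Dᶜ} − u S_D) dU` — every compact gauge
group, uniformly in the defect coupling `u` and in the volume. [ours] -/
theorem defect_variance_le_twoDim (hL : 2 ≤ L) (hρ : Continuous ρ) (β u : ℝ)
    (D : Finset (Plaquette 2 L)) (hD : Dᶜ.Nonempty) :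
    variance (fun U : GaugeConfig 2 L G =>
        ∑ p ∈ D, ((N : ℝ) - (ρ (plaquetteHolonomy U p.1 p.2.1.1 p.2.1.2)).trace.re))
      ((Measure.pi fun _ : Edge 2 L => haarProbability G).tilted fun U =>
        -(β * (∑ p ∈ Dᶜ, ((N : ℝ) - (ρ (plaquetteHolonomy U p.1 p.2.1.1 p.2.1.2)).trace.re))
          + u * (∑ p ∈ D, ((N : ℝ) - (ρ (plaquetteHolonomy U p.1 p.2.1.1 p.2.1.2)).trace.re)))) ≤
      (N : ℝ) ^ 2 * exp (2 * N * |β|) * D.card := by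
  classical
  obtain ⟨p₀, hp₀⟩ := hD
  set x₀ : Site 2 L := p₀.1 with hx₀
  have hx₀D' : x₀ ∉ D.image Prod.fst := by
    intro h
    obtain ⟨q, hq, hq1⟩ := Finset.mem_image.1 h
    have : q = p₀ := plaquette_two_fst_injective hq1
    exact (Finset.mem_compl.1 hp₀) (this ▸ hq)
  have hcardD' : (D.image Prod.fst).card = D.card :=
    Finset.card_image_of_injective _ plaquette_two_fst_injective
  set s : G → ℝ := fun g => (N : ℝ) - (ρ g).trace.re with hs_def
  have hs_cont : Continuous s := continuous_plaqTerm ρ hρ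
  have hs_abs : ∀ g, |s g - N| ≤ N := fun g => by
    have h := plaqTerm_mem_Icc ρ hρ g
    rw [abs_le]; constructor <;> linarith [h.1, h.2]
  let c : Site 2 L → ℝ := fun x => if x ∈ D.image Prod.fst then u else β
  -- the observable `S_D` and the potential as site sums, punctured at `x₀`
  set SD : GaugeConfig 2 L G → ℝ := fun U =>
      ∑ p ∈ D, ((N : ℝ) - (ρ (plaquetteHolonomy U p.1 p.2.1.1 p.2.1.2)).trace.re) with hSD
  set SD' : GaugeConfig 2 L G → ℝ := fun U => ∑ i : {x : Site 2 L // x ≠ x₀},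
      if i.1 ∈ D.image Prod.fst then ((N : ℝ) - (ρ (plaquetteHolonomy U i.1 0 1)).trace.re) else 0
    with hSD'
  have hSDeq : ∀ U, SD U = SD' U := by
    intro U
    simp only [hSD, hSD']
    rw [defectSum_two_eq ρ D U, Fintype.sum_eq_add_sum_compl x₀, if_neg hx₀D', zero_add]
    exact Finset.sum_subtype _ (fun x => by simp [Finset.mem_compl])
      fun x : Site 2 L => if x ∈ D.image Prod.fst then
        ((N : ℝ) - (ρ (plaquetteHolonomy U x 0 1)).trace.re) else 0
  have hSDfun : SD = SD' := funext hSDeq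
  set V : GaugeConfig 2 L G → ℝ := fun U => ∑ i : {x : Site 2 L // x ≠ x₀},
      -(c i.1 * ((N : ℝ) - (ρ (plaquetteHolonomy U i.1 0 1)).trace.re)) with hV
  have hpot : ∀ U : GaugeConfig 2 L G,
      -(β * (∑ p ∈ Dᶜ, ((N : ℝ) - (ρ (plaquetteHolonomy U p.1 p.2.1.1 p.2.1.2)).trace.re))
          + u * (∑ p ∈ D, ((N : ℝ) - (ρ (plaquetteHolonomy U p.1 p.2.1.1 p.2.1.2)).trace.re))) =
        V U + -(β * s (plaquetteHolonomy U x₀ 0 1)) := by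
    intro U
    rw [defect_potential_two_eq ρ D β u U, Fintype.sum_eq_add_sum_compl x₀, if_neg hx₀D', neg_add,
      add_comm, ← Finset.sum_neg_distrib]
    congr 1
    exact Finset.sum_subtype _ (fun x => by simp [Finset.mem_compl])
      fun x : Site 2 L => -((if x ∈ D.image Prod.fst then u else β) *
        ((N : ℝ) - (ρ (plaquetteHolonomy U x 0 1)).trace.re))
  -- measures: `D[U]`, the punctured `ν`, and `μ_{β,u} = ν.tilted(−β s(U_{x₀}))`
  haveI : IsProbabilityMeasure (trivialMeasure G 2 L) := trivialMeasure_isProbabilityMeasure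
  have hVc : Continuous V :=
    continuous_finsetSum _ fun i _ => (continuous_const.mul ((continuous_plaqTerm ρ hρ).comp
      ((continuous_apply i).comp (continuous_holonomies_ne (G := G) x₀)))).neg
  have hexpV : Integrable (fun U => exp (V U)) (trivialMeasure G 2 L) :=
    integrable_trivialMeasure_of_continuous_group (continuous_exp.comp hVc)
  set ν : Measure (GaugeConfig 2 L G) := (trivialMeasure G 2 L).tilted V with hν
  haveI : IsProbabilityMeasure ν := isProbabilityMeasure_tilted hexpV
  have hμ : ((Measure.pi fun _ : Edge 2 L => haarProbability G).tilted fun U =>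
        -(β * (∑ p ∈ Dᶜ, ((N : ℝ) - (ρ (plaquetteHolonomy U p.1 p.2.1.1 p.2.1.2)).trace.re))
          + u * (∑ p ∈ D, ((N : ℝ) - (ρ (plaquetteHolonomy U p.1 p.2.1.1 p.2.1.2)).trace.re)))) =
      ν.tilted fun U => -(β * s (plaquetteHolonomy U x₀ 0 1)) := by
    rw [hν, tilted_tilted hexpV]
    unfold trivialMeasure
    congr 1
    funext U
    rw [hpot U]
    rfl
  haveI hμP : IsProbabilityMeasure (ν.tilted fun U => -(β * s (plaquetteHolonomy U x₀ 0 1))) := by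
    have hh : Continuous fun U : GaugeConfig 2 L G => plaquetteHolonomy U x₀ 0 1 := by
      unfold plaquetteHolonomy; fun_prop
    exact isProbabilityMeasure_tilted (integrable_of_continuous_compactSpace ν
      (continuous_exp.comp (continuous_const.mul (hs_cont.comp hh)).neg))
  rw [hμ, hSDfun]
  -- continuity / integrability of the observable
  have hSD'c : Continuous SD' := by
    refine continuous_finsetSum _ fun i _ => ?_
    by_cases h : i.1 ∈ D.image Prod.fst
    · simp only [if_pos h]
      exact (continuous_plaqTerm ρ hρ).comp ((continuous_apply i).comp (continuous_holonomies_ne (G := G) x₀))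
    · simp only [if_neg h]; exact continuous_const
  set m : ℝ := ∫ U, SD' U ∂ν with hm
  have hhol₀c : Continuous fun U : GaugeConfig 2 L G => plaquetteHolonomy U x₀ 0 1 := by
    unfold plaquetteHolonomy; fun_prop
  have hint_sqν : Integrable (fun U => (SD' U - m) ^ 2) ν :=
    integrable_of_continuous_compactSpace ν ((hSD'c.sub continuous_const).pow 2)
  -- transfer and the punctured variance
  have htrans : ∫ U, (SD' U - m) ^ 2 ∂(ν.tilted fun U => -(β * s (plaquetteHolonomy U x₀ 0 1))) ≤
      exp (2 * (N * |β|)) * (((D.image Prod.fst).card : ℝ) * (N : ℝ) ^ 2) := by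
    have hK : ∀ U : GaugeConfig 2 L G,
        |-(β * s (plaquetteHolonomy U x₀ 0 1)) - (-(β * N))| ≤ N * |β| := by
      intro U
      have : -(β * s (plaquetteHolonomy U x₀ 0 1)) - (-(β * N)) =
          -(β * (s (plaquetteHolonomy U x₀ 0 1) - N)) := by ring
      rw [this, abs_neg, abs_mul, mul_comm]
      exact mul_le_mul_of_nonneg_right (hs_abs _) (abs_nonneg β)
    have h1 := integral_tilted_le_exp_osc_mul (μ := ν)
      ((continuous_const.mul (hs_cont.comp hhol₀c)).neg.measurable) hK (fun U => sq_nonneg _) hint_sqν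
    refine h1.trans ?_
    have hv : ∫ U, (SD' U - m) ^ 2 ∂ν = variance SD' ν := by
      rw [variance_eq_integral hSD'c.measurable.aemeasurable]
    rw [hv]
    gcongr
    exact variance_punctured_indicator_le ρ hL hρ x₀ c (D.image Prod.fst)
  -- conclude: `Var ≤ E[(SD' − m)²] ≤ e^{2N|β|}·#D'·N²`
  have h1 : variance SD' (ν.tilted fun U => -(β * s (plaquetteHolonomy U x₀ 0 1))) =
      variance (fun U => SD' U - m) (ν.tilted fun U => -(β * s (plaquetteHolonomy U x₀ 0 1))) :=
    (variance_sub_const hSD'c.aestronglyMeasurable _).symm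
  have h2 : variance (fun U => SD' U - m) (ν.tilted fun U => -(β * s (plaquetteHolonomy U x₀ 0 1))) ≤
      ∫ U, (SD' U - m) ^ 2 ∂(ν.tilted fun U => -(β * s (plaquetteHolonomy U x₀ 0 1))) := by
    have h := variance_le_expectation_sq (μ := ν.tilted fun U => -(β * s (plaquetteHolonomy U x₀ 0 1)))
      (X := fun U => SD' U - m) (hSD'c.sub continuous_const).aestronglyMeasurable
    simpa only [Pi.pow_apply] using h
  rw [h1, ← hcardD', show 2 * (N : ℝ) * |β| = 2 * (N * |β|) by ring]
  calc variance (fun U => SD' U - m) (ν.tilted fun U => -(β * s (plaquetteHolonomy U x₀ 0 1)))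
      ≤ exp (2 * (N * |β|)) * (((D.image Prod.fst).card : ℝ) * (N : ℝ) ^ 2) := h2.trans htrans
    _ = (N : ℝ) ^ 2 * exp (2 * (N * |β|)) * ((D.image Prod.fst).card : ℝ) := by ring

/-- **The two-dimensional defect ceiling in the family spelling of `Scaling/DefectSwapAcceptance`**:
`Var[−S_D ; ν_β.tilted(v·(−S_D))] ≤ N²·e^{2N|β|}·#D` for EVERY real `v`. [ours] -/
theorem defect_ceiling_family_twoDim (hL : 2 ≤ L) (hρ : Continuous ρ) (β v : ℝ)
    (D : Finset (Plaquette 2 L)) (hD : Dᶜ.Nonempty) :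
    variance (fun U : GaugeConfig 2 L G =>
          -(∑ p ∈ D, ((N : ℝ) - (ρ (plaquetteHolonomy U p.1 p.2.1.1 p.2.1.2)).trace.re)))
        (((Measure.pi fun _ : Edge 2 L => haarProbability G).tilted fun U =>
          -(β * ∑ p ∈ Dᶜ, ((N : ℝ) - (ρ (plaquetteHolonomy U p.1 p.2.1.1 p.2.1.2)).trace.re))).tilted
          fun U => v * (-(∑ p ∈ D, ((N : ℝ) - (ρ (plaquetteHolonomy U p.1 p.2.1.1 p.2.1.2)).trace.re)))) ≤
      (N : ℝ) ^ 2 * exp (2 * N * |β|) * D.card := by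
  rw [defect_family_eq ρ hρ β v D, variance_fun_neg]
  exact defect_variance_le_twoDim ρ hL hρ β v D hD

end DefectTwoDim

end Summit.Ventures.LatticeQCDFlow.Scaling

end
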